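import Summits.QuantumFields.YangMills.Theorems.AlphaInputsT3ACv3StartDefectTwoCell
import Literature.MathematicalPhysics.QuantumFieldTheory.Balaban1983to89.B10Eq42TorusConstraint
import HarnessLib

/-!
# `AlphaInputsT3ACv3StartTwoCellSat` — START v3.1 for the (FL) `hLift` binder, row (S5)-4: **THE TWO-CELL BINDER `htwo` OF `startT3_cert` UNDER SATURATION** — a fine site all of whose
# coordinates lie in ★w5 g2's `twoCellSet k c` lies over `c₋` or `c₊` (converse of `mem_twoCellSet_of_mem_blocks`); hence, if Ω is SATURATED at level `k` (`x ∈ Ω ↔ toFine k (iterBlockOf k x)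
# ∈ Ω`) and `c ∈ bondsIn k Ω`, every finest plaquette whose source and far corner lie in the two-cell product set is CONSTRAINED (`∈ plaqsIn 0 Ω`) — lane `pub-balaban3d` ∕ cell `ym3-torus`,
# seat `ym-ust-19936-w1` (g2, LEAD)

WHY (PROGRESS 7: the seven open lattice binders; `htwo` is the one the (D) row of `startT3_cert` needs).  Saturation at level `k` holds for the binder's region `Ω_{k+1}(h)` (a union of
scale-`(k+1)` big blocks, `Carriers.Omega_bigBlock`), read through `coarsen k = iterBlockOf k` (`AvgIterLocality.coarsen_eq_iterBlockOf`) — discharged at the M22 instantiation.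
WHAT IS HERE: `iterBlockOf_apply_of_mem_twoCellSet` (the block label from the window offset), ★`mem_blocks_of_mem_twoCellSet`, `mem_twoCellSet_corner_μ`∕`_ν` (the two middle corners),
★★`htwo_of_sat`.
HONEST FRAMING.  Lattice bookkeeping; (FL)∕`hLift` NOT proved; count-neutral helper toward R3 2′ (items 19936∕19935); registry untouched; nothing about d = 4, the continuum, or a mass
gap; YM₃ on T³ is rung R3, not Clay.

References: T. Bałaban, Commun. Math. Phys. 109 (1987) 249–301 [Balaban1987RG1] ((0.1) p.251); Commun. Math. Phys. 102 (1985) 277–309 [Balaban1985Variational] ((3) p.278).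
-/

set_option autoImplicit false

noncomputable section

namespace Summit.QuantumFields.YangMills.Theorems.TubeStart

open Literature.MathematicalPhysics.QuantumFieldTheory.Balaban1983to89
open Literature.MathematicalPhysics.QuantumFieldTheory.Balaban1983to89.B5Eq118OneStroke (iterBlockOf val_iterBlockOf)
open Literature.MathematicalPhysics.QuantumFieldTheory.Balaban1983to89.B10Eq38TorusDomains (toFine plaqsIn cornerSet mem_plaqsIn_iff)
open Literature.MathematicalPhysics.QuantumFieldTheory.Balaban1983to89.B10Eq42TorusConstraint (bondsIn mem_bondsIn_iff)
open Summit.QuantumFields.YangMills.Theorems.StartDefectBox (blockStart winHi twoCellSet shift_shift_apply_left shift_shift_apply_right)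

variable {P : Params} {k : ℕ} (hk : k ≤ P.m + P.K) (c : PBond P k)
include hk

/-- **THE BLOCK LABEL FROM THE WINDOW OFFSET**: if `x_κ = start_κ + u` then `(iterBlockOf k x) κ = (c₋)_κ + ⌊u∕L^k⌋` in `ZMod N_k`. [cite: Balaban1987RG1, (0.1) p.251] -/
theorem iterBlockOf_apply_of_offset (x : Site P 0) (κ : Fin P.d) {u : ℕ} (hx : x κ = blockStart k c κ + ((u : ℕ) : ZMod (P.sitesPerDir 0))) :
    iterBlockOf k x κ = c.src κ + (((u / P.L ^ k : ℕ) : ℕ) : ZMod (P.sitesPerDir k)) := by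
  have hm : 0 < P.L ^ k := pow_pos P.L_pos k
  have hx' : x κ = (((((c.src κ).val + u / P.L ^ k) * P.L ^ k + u % P.L ^ k) : ℕ) : ZMod (P.sitesPerDir 0)) := by
    rw [hx, blockStart, ← Nat.cast_add]
    congr 1
    have := Nat.div_add_mod' u (P.L ^ k)
    rw [add_mul]
    omega
  obtain ⟨-, hdiv⟩ := val_mod_div_of_eq_cast hk (Nat.mod_lt u hm) hx'
  have hval : (iterBlockOf k x κ).val = (x κ).val / P.L ^ k := val_iterBlockOf k hk x κ
  have hlt : (x κ).val / P.L ^ k < P.sitesPerDir k := by rw [← hval]; exact ZMod.val_lt _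
  rw [Nat.mod_eq_of_lt hlt] at hdiv
  calc iterBlockOf k x κ = (((iterBlockOf k x κ).val : ℕ) : ZMod (P.sitesPerDir k)) := (ZMod.natCast_zmod_val _).symm
    _ = ((((c.src κ).val + u / P.L ^ k) % P.sitesPerDir k : ℕ) : ZMod (P.sitesPerDir k)) := by rw [hval, hdiv]
    _ = c.src κ + (((u / P.L ^ k : ℕ) : ℕ) : ZMod (P.sitesPerDir k)) := by rw [ZMod.natCast_mod, Nat.cast_add, ZMod.natCast_zmod_val]

/-- **★ A FINE SITE OF THE TWO-CELL PRODUCT SET LIES OVER `c₋` OR `c₊`** (converse of ★w5 g2's `mem_twoCellSet_of_mem_blocks`). [cite: Balaban1987RG1, (0.1) p.251] -/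
theorem mem_blocks_of_mem_twoCellSet (x : Site P 0) (hx : ∀ κ, x κ ∈ twoCellSet k c κ) : iterBlockOf k x = c.src ∨ iterBlockOf k x = c.tgt := by
  have hm : 0 < P.L ^ k := pow_pos P.L_pos k
  -- the offset along `c`
  obtain ⟨ud, hud, hxd⟩ := hx c.dir
  have hwd : winHi k c c.dir = 2 * P.L ^ k - 1 := by unfold winHi; rw [if_pos rfl]
  rw [hwd] at hud
  -- transverse coordinates: offset `< L^k`, block label `(c₋)_κ`
  have htrans : ∀ κ, κ ≠ c.dir → iterBlockOf k x κ = c.src κ := by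
    intro κ hκ
    obtain ⟨u, hu, hxu⟩ := hx κ
    have hw : winHi k c κ = P.L ^ k - 1 := by unfold winHi; rw [if_neg hκ]
    rw [hw] at hu
    rw [iterBlockOf_apply_of_offset hk c x κ hxu, Nat.div_eq_of_lt (by omega), Nat.cast_zero, add_zero]
  have hdir := iterBlockOf_apply_of_offset hk c x c.dir hxd
  by_cases hj : ud < P.L ^ k
  · left
    funext κ
    by_cases hκ : κ = c.dir
    · subst hκ; rw [hdir, Nat.div_eq_of_lt hj, Nat.cast_zero, add_zero]
    · exact htrans κ hκ
  · right
    have hj1 : ud / P.L ^ k = 1 := Nat.div_eq_of_lt_le (by omega) (by omega)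
    funext κ
    by_cases hκ : κ = c.dir
    · subst hκ
      rw [hdir, hj1, Nat.cast_one]
      simp [PBond.tgt, Site.shift]
    · rw [htrans κ hκ]
      simp [PBond.tgt, Site.shift, hκ]

omit hk in
/-- The corner `x + e_μ` of a plaquette whose source and far corner lie in the product set lies in it too. [folklore] -/
theorem mem_twoCellSet_corner_μ (q : Plaq P 0) (h1 : ∀ κ, q.src κ ∈ twoCellSet k c κ) (h4 : ∀ κ, ((q.src.shift q.μ).shift q.ν) κ ∈ twoCellSet k c κ) (κ : Fin P.d) :
    (q.src.shift q.μ) κ ∈ twoCellSet k c κ := by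
  have hμν : q.μ ≠ q.ν := ne_of_lt q.hμν
  by_cases hκ : κ = q.μ
  · subst hκ
    have : (q.src.shift q.μ) q.μ = ((q.src.shift q.μ).shift q.ν) q.μ := by
      rw [shift_shift_apply_left q.src hμν]; simp [Site.shift]
    rw [this]; exact h4 q.μ
  · have : (q.src.shift q.μ) κ = q.src κ := by simp [Site.shift, hκ]
    rw [this]; exact h1 κ

omit hk in
/-- The corner `x + e_ν` likewise. [folklore] -/
theorem mem_twoCellSet_corner_ν (q : Plaq P 0) (h1 : ∀ κ, q.src κ ∈ twoCellSet k c κ) (h4 : ∀ κ, ((q.src.shift q.μ).shift q.ν) κ ∈ twoCellSet k c κ) (κ : Fin P.d) :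
    (q.src.shift q.ν) κ ∈ twoCellSet k c κ := by
  have hμν : q.μ ≠ q.ν := ne_of_lt q.hμν
  by_cases hκ : κ = q.ν
  · subst hκ
    have : (q.src.shift q.ν) q.ν = ((q.src.shift q.μ).shift q.ν) q.ν := by
      rw [shift_shift_apply_right q.src hμν]; simp [Site.shift]
    rw [this]; exact h4 q.ν
  · have : (q.src.shift q.ν) κ = q.src κ := by simp [Site.shift, hκ]
    rw [this]; exact h1 κ

/-- **★★ THE TWO-CELL BINDER `htwo` UNDER SATURATION AT LEVEL `k`**: if `x ∈ Ω ↔ toFine k (iterBlockOf k x) ∈ Ω` for every fine site, then for `c ∈ bondsIn k Ω` every finest plaquette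
with source and far corner in the two-cell product set of `c` is constrained. [cite: Balaban1985Variational, (3) p.278] -/
theorem htwo_of_sat {Ω : Set (Site P 0)} (hsat : ∀ x : Site P 0, x ∈ Ω ↔ toFine k (iterBlockOf k x) ∈ Ω) :
    ∀ c : PBond P k, c ∈ bondsIn k Ω → ∀ q : Plaq P 0, (∀ κ, q.src κ ∈ twoCellSet k c κ) → (∀ κ, ((q.src.shift q.μ).shift q.ν) κ ∈ twoCellSet k c κ) → q ∈ plaqsIn 0 Ω := by
  intro c hc q h1 h4
  rw [mem_bondsIn_iff] at hc
  have hin : ∀ x : Site P 0, (∀ κ, x κ ∈ twoCellSet k c κ) → x ∈ Ω := by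
    intro x hx
    rw [hsat x]
    rcases mem_blocks_of_mem_twoCellSet hk c x hx with h | h
    · rw [h]; exact hc.1
    · rw [h]; exact hc.2
  rw [mem_plaqsIn_iff]
  simp only [cornerSet, Set.insert_subset_iff, Set.singleton_subset_iff, B10Eq38TorusDomains.toFine_zero]
  exact ⟨hin _ h1, hin _ (mem_twoCellSet_corner_μ c q h1 h4), hin _ (mem_twoCellSet_corner_ν c q h1 h4), hin _ h4⟩

end Summit.QuantumFields.YangMills.Theorems.TubeStart

end
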